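import Literature.Analysis.FluidPDE.TypeIAncientMild
import Literature.Analysis.FluidPDE.ChaeWolfRemovingDSSBounds
import Literature.Analysis.FluidPDE.ParasiticSlabFlow
import Literature.Analysis.FluidPDE.SereginSverakBlowupSelection
import HarnessLib

/-! # The KNSS mild gauge is automatic under Type-I decay — crux stmt-NavierStokesRegularity-1404 (`QuantisedSymmetry.PolyhedralDssProfileExists`), line birth, stub stub_ancientMild_of_classical_typeI

Registered stub `stub_ancientMild_of_classical_typeI` (`--supports stmt-NavierStokesRegularity-1404`):
a classical Navier–Stokes solution `(u, p)` on the past `(−∞, 0) × ℝ³` (`ν = 1`, zero force) with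
the Type-I space–time bound `‖u(t, x)‖ ≤ C₀/(‖x‖ + √(−t))` (`HasTypeIDecay C₀ u`) is an ancient
mild solution in the duality sense of the tree (`IsAncientMildSolution 1 u`).

Proof (assembly of proved tree facts). The Type-I bound forces `0 ≤ C₀`
(`nonneg_of_hasTypeIDecay`) and gives, on every window `(s − 1, t]` with `s < t < 0`, a uniform
bound `‖u‖ ≤ C₀/√(−t)` and the weighted bound `cylRadius y · ‖u(t', y)‖ ≤ C₀` (as
`cylRadius y ≤ ‖y‖`, `SereginSverak2009.cylRadius_le_norm'`). The discharged named fact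
`KNSS2009_mild_of_rMulNorm_bounded_holds` (Koch–Nadirashvili–Seregin–Šverák 2009, Thm 6.1,
mildness clause) then yields the Oseen representation formula
`u(t) = e^{(t−s)Δ}u(s) − B¹_s(u,u)(t)` between all `s < t < 0`; together with joint smoothness,
`div u = 0` and `HasTypeITimeDecay C₀ u` this is `IsTypeIAncientMild C₀ u`, and
`IsTypeIAncientMild.isAncientMildSolution` concludes. This mirrors the KNSS step of
`ChaeWolf.exists_eps_typeI_small_eq_zero`.
-/

noncomputable section

-- the summit namespace `…NavierStokesRegularity.NavierStokesRegularity…` is the tree convention (D-0017)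
set_option linter.dupNamespace false

namespace Summit.NavierStokesRegularity.NavierStokesRegularity.Theorems.PolyhedralDssProfileExists.Birth

open MeasureTheory Set Function Filter
open Literature.Analysis.FluidPDE

/-- Local notation for physical space `ℝ³ = EuclideanSpace ℝ (Fin 3)` (the registered stub signature is
spelled with it). -/
local notation "ℝ³" => EuclideanSpace ℝ (Fin 3)

/-- **The Oseen representation formula for Type-I classical solutions on the past** (KNSS 2009,
Thm 6.1, mildness clause, via the discharged named fact `KNSS2009_mild_of_rMulNorm_bounded_holds`):
a classical solution of Navier–Stokes (`ν = 1`, `f = 0`) on `(−∞, 0) × ℝ³` with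
`‖u(t, x)‖ ≤ C₀/(‖x‖ + √(−t))` satisfies `u(t) = e^{(t−s)Δ}u(s) − B¹_s(u,u)(t)` for all
`s < t < 0`. -/
theorem mild_eq_of_classical_typeI {u : ℝ → ℝ³ → ℝ³} {p : ℝ → ℝ³ → ℝ} {C₀ : ℝ}
    (hcl : IsClassicalNSSolutionOn (Iio 0) 1 0 u p) (hI : HasTypeIDecay C₀ u) {s t : ℝ}
    (hst : s < t) (ht : t < 0) (x : ℝ³) :
    u t x = heatFlow (u s) (t - s) x - oseenDuhamel 1 s u u t x := by
  have hC₀ : 0 ≤ C₀ := nonneg_of_hasTypeIDecay hI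
  rw [heatFlow_of_pos _ (sub_pos.2 hst)]
  -- restrict to the open window `(s - 1, 0)`
  have hcl' : IsClassicalNSSolutionOn (Ioo (s - 1) 0) 1 0 u p :=
    hcl.mono Ioo_subset_Iio_self (uniqueDiffOn_Ioo _ _)
  -- uniform bound on `(s - 1, t]`
  have hL : ∃ L : ℝ, ∀ t' ∈ Ioc (s - 1) t, ∀ y, ‖u t' y‖ ≤ L := by
    refine ⟨C₀ / √(-t), fun t' ht' y => ?_⟩
    have ht'0 : t' < 0 := lt_of_le_of_lt ht'.2 ht
    refine (hI.hasTypeITimeDecay hC₀ t' ht'0 y).trans ?_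
    exact div_le_div_of_nonneg_left hC₀ (Real.sqrt_pos.2 (by linarith))
      (Real.sqrt_le_sqrt (by linarith [ht'.2]))
  -- weighted bound `cylRadius y * ‖u t' y‖ ≤ C₀` on `(s - 1, t]`
  have hD : ∃ D : ℝ, ∀ t' ∈ Ioc (s - 1) t, ∀ y, cylRadius y * ‖u t' y‖ ≤ D := by
    refine ⟨C₀, fun t' ht' y => ?_⟩
    have ht'0 : t' < 0 := lt_of_le_of_lt ht'.2 ht
    have hs : 0 < √(-t') := Real.sqrt_pos.2 (by linarith)
    have hden : 0 < ‖y‖ + √(-t') := by positivity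
    calc cylRadius y * ‖u t' y‖ ≤ ‖y‖ * (C₀ / (‖y‖ + √(-t'))) := by
          gcongr
          · exact SereginSverak2009.cylRadius_le_norm' y
          · exact hI t' ht'0 y
      _ = C₀ * (‖y‖ / (‖y‖ + √(-t'))) := by ring
      _ ≤ C₀ * 1 := by
          gcongr
          rw [div_le_one hden]
          linarith [hs.le]
      _ = C₀ := mul_one _
  exact KNSS2009_mild_of_rMulNorm_bounded_holds hcl' (by linarith) ht hL hD
    (s := s) (t := t) (by linarith) hst le_rfl x

/-- **Type-I classical solutions on the past are Type-I ancient mild fields in the KNSS gauge**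
(`IsTypeIAncientMild C₀ u`): joint smoothness and `div u = 0` from the classical solution, the
Oseen representation formula between all `s < t < 0` from `mild_eq_of_classical_typeI`
(KNSS 2009, Thm 6.1), and the Type-I temporal bound from the space–time one. -/
theorem isTypeIAncientMild_of_classical_typeI {u : ℝ → ℝ³ → ℝ³} {p : ℝ → ℝ³ → ℝ} {C₀ : ℝ}
    (hcl : IsClassicalNSSolutionOn (Iio 0) 1 0 u p) (hI : HasTypeIDecay C₀ u) :
    IsTypeIAncientMild C₀ u :=
  ⟨hcl.smooth_velocity, fun t ht => hcl.divFree t ht,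
    fun _ _ hst ht x => mild_eq_of_classical_typeI hcl hI hst ht x,
    hI.hasTypeITimeDecay (nonneg_of_hasTypeIDecay hI)⟩

/-- **Stub `stub_ancientMild_of_classical_typeI` (the KNSS mild gauge is automatic under Type-I
decay).** A classical Navier–Stokes solution `(u, p)` on the past `(−∞, 0) × ℝ³` (`ν = 1`, zero
force) with the Type-I bound `‖u(t, x)‖ ≤ C₀/(‖x‖ + √(−t))` is an ancient mild solution in the
duality sense (`IsAncientMildSolution 1 u`): weakly divergence-free slices and the two-time duality
identity between all `s < t < 0` (KNSS 2009, Thm 6.1 mildness clause and §6; Seregin–Šverák 2009,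
(1.1)), via `isTypeIAncientMild_of_classical_typeI` and
`IsTypeIAncientMild.isAncientMildSolution`. -/
theorem stub_ancientMild_of_classical_typeI :
    ∀ (u : ℝ → ℝ³ → ℝ³) (p : ℝ → ℝ³ → ℝ) (C₀ : ℝ),
      IsClassicalNSSolutionOn (Iio 0) 1 0 u p → HasTypeIDecay C₀ u → IsAncientMildSolution 1 u :=
  fun _ _ _ hcl hI => (isTypeIAncientMild_of_classical_typeI hcl hI).isAncientMildSolution

end Summit.NavierStokesRegularity.NavierStokesRegularity.Theorems.PolyhedralDssProfileExists.Birth
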